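import Literature.NumberTheory.EllipticCurves.PAdicLFunctionQuadraticTwistCongruenceAtTwoProofs
import Summits.BirchSwinnertonDyer.Rank2.LevelFifteenDescentParity
import HarnessLib

/-!
# The tame measure of `15A8` is `ℤ₂`-valued on the unit classes (halved tame congruence at `2`, part 1)

Cell `bsd-rank2`, seat p2, GEN 64 (helper toward `EisensteinDepletionAtTwo.DepletedLambdaLawAtTwoModNSF`).
`E₀ = 15A8 = [1,1,1,0,0]`, `f` its newform, `α` the unit root of `X² + X + 2` (`a₂(E₀) = −1`).

In the tree's `Ω⁺`-normalisation `L₂(f, α) = 2·ι(u)`, `u ∈ Λˣ` (`LevelFifteen.refFifteen_exists_isUnit_iwasawa`), so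
`μ^{an}(E₀) = 1` and Matsuno's mod-`2` twist congruence transports nothing from `E₀`.  The repair starts here: the
level-15 exact symbol law (`LevelFifteen.ratPlusSymbol_refFifteen_exact`, extended to every cusp `c/M` with
`(15c, M) = 1` through a Bézout `c·d − b·M = 1`, `15 ∣ d`): `[c/M]⁺_f = −s/8 + s·k/2`, `k ≡ [M ≡ ±2 (5)] (mod 2)`,
makes the tame measure `μ_{f,α,m}(a + 2ᴺℤ₂, b) = α⁻ᴺ[c₀/2ᴺm]⁺ − α⁻ᴺ⁻¹[c₀/2ᴺ⁻¹m]⁺` **`ℤ₂`-valued on the unit classes**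
(`a` odd, `b ∈ (ℤ/m)ˣ`, `(m, 30) = 1`): the two `k`'s have opposite parity since exactly one of `2ᴺm`, `2ᴺ⁻¹m` is
`≡ ±2 (mod 5)`, and `1 − α⁻¹ = 4α⁻³` — one factor `2` sharper than the generic bound
`norm_msdMeasureTame_unitRoot_two_le_two_auto`.  Part 2 (`RefFifteenHalvedTameCongruence`) turns this into the halved
twist congruence and the analytic Kida formula on the twist class of `15A8`.

B1 honesty: statements about modular symbols and `2`-adic measures only.
-/

noncomputable section

open scoped Classical MatrixGroups ModularForm NumberTheorySymbols

open CongruenceSubgroup WeierstrassCurve Literature.NumberTheory.EllipticCurves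
  Literature.NumberTheory.EllipticCurves.ModularForms
  Summit.BirchSwinnertonDyer.Rank2 Summit.BirchSwinnertonDyer.Rank2.SymbolParityAtTwo
  Summit.BirchSwinnertonDyer.Rank2.LevelFifteen

namespace Summit.BirchSwinnertonDyer.BirchSwinnertonDyer.Theorems.RefFifteenHalvedTameMeasure

/-! ## §1. Arithmetic helpers -/

section Helpers

/-- `‖2‖₂ = 1/2`. [folklore] -/
private theorem norm_two_two : ‖(2 : ℚ_[2])‖ = (2 : ℝ)⁻¹ := by
  have h := Padic.norm_p (p := 2)
  simpa using h

/-- An even integer has `2`-adic norm `≤ 1/2`. [folklore] -/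
private theorem norm_two_mul_intCast_le (z : ℤ) : ‖(2 : ℚ_[2]) * (z : ℚ_[2])‖ ≤ (2 : ℝ)⁻¹ := by
  rw [norm_mul, norm_two_two]
  calc (2 : ℝ)⁻¹ * ‖(z : ℚ_[2])‖ ≤ 2⁻¹ * 1 := by gcongr; exact Padic.norm_int_le_one z
    _ = 2⁻¹ := mul_one _


/-- **Bézout with `15 ∣ d` for a general modulus**: if `(15c, M) = 1` then `c·d − b·M = 1` with `15 ∣ d`
(`d = 15·((15c)⁻¹ mod M)`). [folklore] -/
theorem exists_bezout_fifteen (M c : ℕ) [NeZero M] (hcop : Nat.Coprime (15 * c) M) :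
    ∃ b d : ℤ, (c : ℤ) * d - b * M = 1 ∧ (15 : ℤ) ∣ d := by
  set t : ℕ := ((((15 * c : ℕ) : ZMod M))⁻¹).val with ht
  have hdvd : (M : ℤ) ∣ (c : ℤ) * (15 * t) - 1 := by
    have h1 := ZMod.coe_mul_inv_eq_one (15 * c) hcop
    have h2 : (((15 * c * t : ℕ)) : ZMod M) = ((1 : ℕ) : ZMod M) := by
      rw [Nat.cast_mul (15 * c) t, ht, ZMod.natCast_zmod_val, h1, Nat.cast_one]
    have hmod : 15 * c * t ≡ 1 [MOD M] := (ZMod.natCast_eq_natCast_iff _ _ _).mp h2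
    have h3 := Nat.modEq_iff_dvd.mp hmod
    rw [dvd_sub_comm] at h3
    push_cast at h3
    have e : (c : ℤ) * (15 * t) - 1 = 15 * (c : ℤ) * (t : ℤ) - 1 := by ring
    rw [e]; exact h3
  refine ⟨((c : ℤ) * (15 * t) - 1) / M, 15 * t, ?_, dvd_mul_right _ _⟩
  rw [Int.ediv_mul_cancel hdvd]; ring

/-- **The halved value bound**: for `α` the unit root of `X² + X + 2` and integers with `K + k₁ − k₂` EVEN,
`‖α⁻ⁿ(K/8 + k₁/2) − α⁻ⁿ⁻¹(K/8 + k₂/2)‖₂ ≤ 1` (`= (α⁻ⁿ/2)·(2z + K(α⁻³ − 1) + k₂(1 − α⁻¹))`, bracket `∈ 2ℤ₂`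
by `1 − α⁻¹ = 4α⁻³`). [cite: MazurTateTeitelbaum1986Invent, §I.10 (10.1)] -/
theorem norm_halvedValue_le_one {α : ℚ_[2]} (hαu : ‖α‖ = 1) (hroot : α ^ 2 + α + 2 = 0)
    {K k₁ k₂ z : ℤ} (hz : K + k₁ - k₂ = 2 * z) (n : ℕ) :
    ‖α⁻¹ ^ n * ((K : ℚ_[2]) / 8 + (k₁ : ℚ_[2]) / 2) -
        α⁻¹ ^ (n + 1) * ((K : ℚ_[2]) / 8 + (k₂ : ℚ_[2]) / 2)‖ ≤ 1 := by
  have hα0 : α ≠ 0 := by rintro rfl; norm_num at hroot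
  have hβ : ‖α⁻¹‖ ≤ 1 := by rw [norm_inv, hαu, inv_one]
  have h1β : 1 - α⁻¹ = 4 * α⁻¹ ^ 3 := one_sub_inv_eq_four_mul hroot
  have hid : α⁻¹ ^ n * ((K : ℚ_[2]) / 8 + (k₁ : ℚ_[2]) / 2) -
      α⁻¹ ^ (n + 1) * ((K : ℚ_[2]) / 8 + (k₂ : ℚ_[2]) / 2) =
      α⁻¹ ^ n * 2⁻¹ *
        ((2 : ℚ_[2]) * z + (K : ℚ_[2]) * (α⁻¹ ^ 3 - 1) + (k₂ : ℚ_[2]) * (1 - α⁻¹)) := by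
    have hz' : (K : ℚ_[2]) + k₁ - k₂ = 2 * z := by exact_mod_cast hz
    linear_combination (α⁻¹ ^ n * (K : ℚ_[2]) / 8) * h1β + (α⁻¹ ^ n * 2⁻¹) * hz'
  rw [hid]
  have h4 : ‖(4 : ℚ_[2]) * α⁻¹ ^ 3‖ ≤ 2⁻¹ := by
    have h44 : (4 : ℚ_[2]) = 2 * 2 := by norm_num
    have hb3 : ‖α⁻¹‖ ^ 3 ≤ 1 := pow_le_one₀ (norm_nonneg _) hβ
    rw [h44, norm_mul, norm_mul, norm_two_two, norm_pow]
    calc (2 : ℝ)⁻¹ * 2⁻¹ * ‖α⁻¹‖ ^ 3 ≤ 2⁻¹ * 2⁻¹ * 1 := by gcongr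
      _ ≤ 2⁻¹ := by norm_num
  have ht1 : ‖(2 : ℚ_[2]) * z‖ ≤ 2⁻¹ := norm_two_mul_intCast_le z
  have ht2 : ‖(K : ℚ_[2]) * (α⁻¹ ^ 3 - 1)‖ ≤ 2⁻¹ := by
    have hfac : α⁻¹ ^ 3 - 1 = -((4 : ℚ_[2]) * α⁻¹ ^ 3) * (α⁻¹ ^ 2 + α⁻¹ + 1) := by
      rw [← h1β]; ring
    have hq : ‖α⁻¹ ^ 2 + α⁻¹ + 1‖ ≤ 1 := by
      refine (Padic.nonarchimedean _ _).trans (max_le ?_ (by rw [norm_one]))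
      refine (Padic.nonarchimedean _ _).trans (max_le ?_ hβ)
      rw [norm_pow]; exact pow_le_one₀ (norm_nonneg _) hβ
    have hK1 : ‖(K : ℚ_[2])‖ ≤ 1 := Padic.norm_int_le_one K
    rw [hfac, norm_mul, norm_mul, norm_neg]
    calc ‖(K : ℚ_[2])‖ * (‖(4 : ℚ_[2]) * α⁻¹ ^ 3‖ * ‖α⁻¹ ^ 2 + α⁻¹ + 1‖) ≤ 1 * (2⁻¹ * 1) := by
          gcongr
      _ = 2⁻¹ := by ring
  have ht3 : ‖(k₂ : ℚ_[2]) * (1 - α⁻¹)‖ ≤ 2⁻¹ := by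
    have hk1 : ‖(k₂ : ℚ_[2])‖ ≤ 1 := Padic.norm_int_le_one k₂
    rw [h1β, norm_mul]
    calc ‖(k₂ : ℚ_[2])‖ * ‖(4 : ℚ_[2]) * α⁻¹ ^ 3‖ ≤ 1 * 2⁻¹ := by gcongr
      _ = 2⁻¹ := one_mul _
  have hB : ‖(2 : ℚ_[2]) * z + (K : ℚ_[2]) * (α⁻¹ ^ 3 - 1) + (k₂ : ℚ_[2]) * (1 - α⁻¹)‖ ≤ 2⁻¹ :=
    (Padic.nonarchimedean _ _).trans (max_le ((Padic.nonarchimedean _ _).trans (max_le ht1 ht2)) ht3)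
  rw [norm_mul, norm_mul, norm_inv, norm_two_two, inv_inv, norm_pow]
  calc ‖α⁻¹‖ ^ n * 2 * _ ≤ 1 * 2 * 2⁻¹ := by
        gcongr
        exact pow_le_one₀ (norm_nonneg _) hβ
    _ = 1 := by norm_num

end Helpers

/-! ## §2. The tame measure of `15A8` is `ℤ₂`-valued on the unit classes -/

section Measure

variable {N : ℕ} [NeZero N]

/-- **The level-15 symbol law at EVERY cusp `c/M` with `(15c, M) = 1`**: `[c/M]⁺_f = −s/8 + s·k/2` with
`k ≡ [M ≡ ±2 (mod 5)] (mod 2)` (`s = ±1` the sign of `[0]⁺_f = −s/8`), from the exact level-15 symbols and the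
descent parity (`LevelFifteen.ratPlusSymbol_refFifteen_exact`, `descent_fst_parity_of_fifteen_dvd`) through the
Bézout `c·d − b·M = 1`, `15 ∣ d`. [cite: Manin1972, Thm. 1.6] [cite: CremonaAlgorithms1997, §2.8 and Table 4 (N = 15)] -/
theorem refFifteen_symbol_law (f : CuspForm (Gamma0 N) 2)
    (hW : IsNewformOf (⟨1, 1, 1, 0, 0⟩ : WeierstrassCurve ℚ) f) :
    ∃ s : ℤ, (s = 1 ∨ s = -1) ∧ ratPlusSymbol f 0 = -(s : ℚ) / 8 ∧
      ∀ (M c : ℕ), M ≠ 0 → Nat.Coprime (15 * c) M →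
        ∃ k : ℤ, ratPlusSymbol f ((c : ℚ) / (M : ℚ)) = -(s : ℚ) / 8 + (((s * k : ℤ)) : ℚ) / 2 ∧
          (2 : ℤ) ∣ k - (if (M : ℤ) % 5 = 2 ∨ (M : ℤ) % 5 = 3 then 1 else 0) := by
  obtain ⟨s, hs, h0, hlaw⟩ := ratPlusSymbol_refFifteen_exact f hW
  refine ⟨s, hs, h0, fun M c hM hcop ↦ ?_⟩
  haveI : NeZero M := ⟨hM⟩
  obtain ⟨b, d, hbez, h15⟩ := exists_bezout_fifteen M c hcop
  have hM0 : (M : ℤ) ≠ 0 := by exact_mod_cast hM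
  have h := hlaw (c : ℤ) b (M : ℤ) d hbez hM0 h15
  have hcast : (((c : ℤ) : ℚ) / (((M : ℤ)) : ℚ)) = (c : ℚ) / (M : ℚ) := by push_cast; rfl
  rw [hcast] at h
  have hcopr : IsCoprime (M : ℤ) d := ⟨-b, c, by linear_combination hbez⟩
  exact ⟨(descent (M : ℤ) d).1, h, descent_fst_parity_of_fifteen_dvd hcopr h15⟩

variable {m : ℕ} [NeZero m]

/-- **`‖μ_{f,α,m}(a + 2ᴺ⁺¹ℤ₂, b)‖₂ ≤ 1` for `15A8` on the UNIT classes** (`a` odd, `b ∈ (ℤ/m)ˣ`, `(m, 30) = 1`,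
`α` the unit root of `X² + X + 2`): the representative `c₀` of `(a, b)` has `(15c₀, 2ʲm) = 1`, the two symbols
`[c₀/2ᴺ⁺¹m]⁺`, `[c₀/2ᴺm]⁺` are `−s/8 + s·kᵢ/2` with `k₁ ≢ k₂ (mod 2)` (exactly one of `2ᴺ⁺¹m`, `2ᴺm` is
`≡ ±2 (mod 5)`, as `5 ∤ m`), and the halved value bound applies — one factor `2` sharper than the generic
`norm_msdMeasureTame_unitRoot_two_le_two_auto`. [cite: MazurTateTeitelbaum1986Invent, §I.10 (10.1) (pp. 12–13)] -/
theorem refFifteen_norm_msdMeasureTame_le_one {f : CuspForm (Gamma0 N) 2}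
    (hW : IsNewformOf (⟨1, 1, 1, 0, 0⟩ : WeierstrassCurve ℚ) f)
    {α : ℚ_[2]} (hαu : ‖α‖ = 1) (hroot : α ^ 2 + α + 2 = 0) (hm30 : m.Coprime 30)
    (n : ℕ) (a : ZMod (2 ^ (n + 1))) (ha : Odd a.val) (b : ZMod m) (hb : IsUnit b) :
    ‖msdMeasureTame f m α (n + 1) a b‖ ≤ 1 := by
  obtain ⟨s, hs, -, hlaw⟩ := refFifteen_symbol_law f hW
  have hm2 : m.Coprime 2 := Nat.Coprime.coprime_dvd_right (by norm_num : 2 ∣ 30) hm30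
  have hm5 : m.Coprime 5 := Nat.Coprime.coprime_dvd_right (by norm_num : 5 ∣ 30) hm30
  have hm15 : m.Coprime 15 := Nat.Coprime.coprime_dvd_right (by norm_num : 15 ∣ 30) hm30
  have hm0 : m ≠ 0 := NeZero.ne m
  obtain ⟨c₀, hc₀⟩ : ∃ c₀ : ℕ, tameRep 2 m (n + 1) a b = c₀ := ⟨_, rfl⟩
  -- residues of the representative
  have hleft : ((c₀ : ℕ) : ZMod (2 ^ (n + 1))) = a := by rw [← hc₀]; exact natCast_tameRep_left Nat.prime_two hm2 a b
  have hright : ((c₀ : ℕ) : ZMod m) = b := by rw [← hc₀]; exact natCast_tameRep_right hm2 a b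
  have hc₀odd : Odd c₀ := by
    have hval : a.val = c₀ % 2 ^ (n + 1) := by rw [← hleft, ZMod.val_natCast]
    have h1 := Nat.odd_iff.mp ha
    rw [hval, Nat.mod_mod_of_dvd _ (dvd_pow_self 2 (Nat.succ_ne_zero n))] at h1
    exact Nat.odd_iff.mpr h1
  have hc₀m : Nat.Coprime c₀ m := by
    have hu : IsUnit ((c₀ : ℕ) : ZMod m) := by rw [hright]; exact hb
    exact (ZMod.isUnit_iff_coprime c₀ m).mp hu
  have h15c : Nat.Coprime (15 * c₀) m := Nat.Coprime.mul_left hm15.symm hc₀m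
  have h15c2 : ∀ j, Nat.Coprime (15 * c₀) (2 ^ j) := fun j ↦
    (Nat.coprime_two_right.mpr ((show Odd 15 by decide).mul hc₀odd)).pow_right j
  have hcopM : ∀ j, Nat.Coprime (15 * c₀) (2 ^ j * m) := fun j ↦ Nat.Coprime.mul_right (h15c2 j) h15c
  have hMne : ∀ j, 2 ^ j * m ≠ 0 := fun j ↦ mul_ne_zero (pow_ne_zero _ two_ne_zero) hm0
  obtain ⟨k₁, hk₁, hd₁⟩ := hlaw (2 ^ (n + 1) * m) c₀ (hMne (n + 1)) (hcopM (n + 1))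
  obtain ⟨k₂, hk₂, hd₂⟩ := hlaw (2 ^ n * m) c₀ (hMne n) (hcopM n)
  -- the two arguments of the measure
  have hx : tameFraction 2 m (n + 1) a b = (c₀ : ℚ) / ((2 ^ (n + 1) * m : ℕ) : ℚ) := by
    rw [tameFraction, hc₀]; push_cast; ring
  have hx2 : (2 : ℚ) * tameFraction 2 m (n + 1) a b = (c₀ : ℚ) / ((2 ^ n * m : ℕ) : ℚ) := by
    have hm0' : (m : ℚ) ≠ 0 := by exact_mod_cast hm0
    rw [hx]; push_cast; field_simp; ring
  -- the parity bookkeeping: `k₁ − k₂` is odd, so `−s + s k₁ − s k₂` is even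
  obtain ⟨z, hz⟩ : ∃ z : ℤ, (-s) + s * k₁ - s * k₂ = 2 * z := by
    have hM : ((2 ^ (n + 1) * m : ℕ) : ℤ) = 2 * ((2 ^ n * m : ℕ) : ℤ) := by push_cast; ring
    have h5n : ¬ 5 ∣ 2 ^ n * m :=
      (Nat.Prime.coprime_iff_not_dvd (by norm_num)).mp
        (Nat.Coprime.mul_left (Nat.Coprime.pow_left n (by norm_num : Nat.Coprime 2 5)) hm5).symm
    have h5 : ¬ (5 : ℤ) ∣ ((2 ^ n * m : ℕ) : ℤ) := by exact_mod_cast h5n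
    rw [hM] at hd₁
    generalize hM₂ : ((2 ^ n * m : ℕ) : ℤ) = M₂ at hd₁ hd₂ h5
    obtain ⟨t, ht⟩ : ∃ t : ℤ, k₁ - k₂ - 1 = 2 * t := by
      by_cases hc : M₂ % 5 = 2 ∨ M₂ % 5 = 3
      · have hc' : ¬ (2 * M₂ % 5 = 2 ∨ 2 * M₂ % 5 = 3) := by omega
        rw [if_neg hc'] at hd₁
        rw [if_pos hc] at hd₂
        obtain ⟨w₁, hw₁⟩ := hd₁
        obtain ⟨w₂, hw₂⟩ := hd₂
        exact ⟨w₁ - w₂ - 1, by omega⟩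
      · have hc' : 2 * M₂ % 5 = 2 ∨ 2 * M₂ % 5 = 3 := by omega
        rw [if_pos hc'] at hd₁
        rw [if_neg hc] at hd₂
        obtain ⟨w₁, hw₁⟩ := hd₁
        obtain ⟨w₂, hw₂⟩ := hd₂
        exact ⟨w₁ - w₂, by omega⟩
    exact ⟨s * t, by linear_combination s * ht⟩
  -- unfold the measure and apply the halved value bound
  rw [msdMeasureTame]
  have hcast : ((2 : ℕ) : ℚ) = (2 : ℚ) := by norm_num
  rw [hcast, hx2, hx, hk₁, hk₂]
  have e : ∀ k : ℤ, (((-(s : ℚ) / 8 + ((s * k : ℤ) : ℚ) / 2 : ℚ)) : ℚ_[2]) =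
      (((-s : ℤ)) : ℚ_[2]) / 8 + (((s * k : ℤ)) : ℚ_[2]) / 2 := fun k ↦ by push_cast; ring
  rw [e k₁, e k₂]
  exact norm_halvedValue_le_one hαu hroot hz (n + 1)

end Measure

end Summit.BirchSwinnertonDyer.BirchSwinnertonDyer.Theorems.RefFifteenHalvedTameMeasure

end
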